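/-
Origin: expansion seat `planner-pub-hodgecm-pv07-0`, handover 2026-08-18T03:35:56Z (`HOME/pub-hodgecm-pv07/lean/Pv07/SplitFactor.lean`, md5 43368752, 146 lines);
landed by the gen-5 packager in gate run 19 as `HodgeCM/PerL34/LocalFactors/SplitFactor.lean` (import ^import Pv07\.(BallDichotomy|SplitFactor|CompactFactor|KernelRadius)\b→import HodgeCM.PerL34.LocalFactors.\1 ×1).
-/
/-
Copyright: pub-hodgecm formalisation cell (harness21, 2026). New file (not vendored).
Origin: pub-hodgecm-pv07 (DAG-NODE PROVER #07), node N31f = PerL v5 Lemma 4.2(b), proof step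
"LOCAL FACTORS" (tex ll. 608–623).  This file: the SPLIT-PLACE FACTOR `I_v = vol(D)·vol(U₁) > 0`
(tex ll. 617–623), from the ball lemma `Pv07.BallDichotomy`.
Intended final place: `HodgeCM/PerL34/LocalFactors/SplitFactor.lean` (packager's choice; the
import below then becomes `HodgeCM.PerL34.LocalFactors.BallDichotomy`).
-/
import Summits.HodgeConjecture.HodgeCM.PerL34.LocalFactors.BallDichotomy

/-!
# N31f (iii) — the split-place local factor: `m = vol(D)𝟙_{U₁}`, `I_v(φ_v) = vol(D)vol(U₁) > 0`

Verbatim (tex ll. 610–611, 620–623): at a place `v` of `L₀` split in `L`, `U(W_i)(L_{0,v})` "is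
`L_{0,v}^×` acting on `𝒮(L_{0,v}^3)` by `(ω(y)φ)(x) = |y|^{3/2}φ(yx)` up to a unitary character",
`U₁` "lies in the kernels of `χ'_v` and of the auxiliary unitary character of the Weil
representation; … hence `m = vol(D)𝟙_{U₁}` and `I_v(φ_v) = vol(D)vol(U₁) > 0`."

TYPING (pv07's).  With `φ_v = 𝟙_D`, `D = closedBall x₀ r` (`Pv07.BallDichotomy` dictionary), the
Schrödinger-model formula gives, for `y ∈ L_{0,v}^×`,
  `m(y) = ⟨ω(y)𝟙_D, 𝟙_D⟩ = ν(y)|y|^{3/2} ∫ 𝟙_D(yx)𝟙_D(x) dx = a(y) · vol{x ∈ D : yx ∈ D}`,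
`a(y) := ν(y)|y|^{3/2}` (`= 1` on `U₁`: `|y| = 1` there, `BallDichotomy.norm_eq_one_of_mem_U1`, and
`U₁ ⊂ ker ν`).  We therefore DEFINE `ballCoeff a μ x₀ r y := a(y) · μ.real (D ∩ (y•)⁻¹ D)` for an
arbitrary weight `a` and an arbitrary measure `μ` on `ι → F` (PerL: additive Haar measure `dx` on
`L_{0,v}^3`), and the local factor as `∫ ballCoeff(y)·χ(y) dη(y)` for an arbitrary measure `η` on
`F` (PerL: the Haar measure `d^×y` of `L_{0,v}^×`; on `U₁ ⊂ 𝒪^×` one has `|y| = 1`, so there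
`d^×y = |y|⁻¹dy` IS additive Haar measure up to the normalising constant — `withDensity_inv_norm_U1`
below makes this precise) and an arbitrary `χ` trivial on `U₁` (PerL: `U₁ ⊂ ker χ'_v`).
The identification of `⟨ω_v(y)φ_v, φ_v⟩` with `ballCoeff` — i.e. the Schrödinger model of the
split Weil representation — is a PRINT INPUT recorded in `GAPS.md` (N31f-G1), not proved here.

PROVED here (kernel):
* "`m = vol(D)𝟙_{U₁}`": `ballCoeff_eq_indicator`;
* "`I_v(φ_v) = vol(D)vol(U₁)`": `integral_ballCoeff_mul_eq`;
* "`> 0`": `ballFactor_pos` — `vol(D) > 0` and `vol(U₁) > 0` (and both finite) for every measure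
  positive on open sets and finite on compact sets over a locally compact (`ProperSpace`) field,
  in particular for Haar measures; `exists_integral_ballCoeff_pos` packages the conclusion
  "`I_v(φ_v)` is a positive real number".
-/

set_option autoImplicit false

namespace HodgeCM
namespace PerL34
namespace LocalFactors

open Metric Set MeasureTheory
open scoped Pointwise

variable {F : Type*} [NormedField F] [IsUltrametricDist F]
variable {ι : Type*} [Fintype ι] [MeasurableSpace (ι → F)]

/-- The Schrödinger-model matrix coefficient of `φ_v = 𝟙_D` (tex l. 611 with l. 613, 621–622):
`m(y) = a(y) · vol{x ∈ D : yx ∈ D}`, `a(y) = ν(y)|y|^{3/2}`. -/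
noncomputable def ballCoeff (a : F → ℂ) (μ : Measure (ι → F)) (x₀ : ι → F) (r : ℝ) (y : F) : ℂ :=
  a y * (μ.real (closedBall x₀ r ∩ (fun x => y • x) ⁻¹' closedBall x₀ r) : ℂ)

/-- tex l. 622: "hence `m = vol(D)𝟙_{U₁}`" (for any weight `a` equal to `1` on `U₁`). -/
theorem ballCoeff_eq_indicator {a : F → ℂ} {μ : Measure (ι → F)} {x₀ : ι → F} {r : ℝ}
    (hr : r < ‖x₀‖) (ha : ∀ y ∈ U1 x₀ r, a y = 1) :
    ballCoeff a μ x₀ r = (U1 x₀ r).indicator fun _ => (μ.real (closedBall x₀ r) : ℂ) := by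
  funext y
  by_cases hy : y ∈ U1 x₀ r
  · rw [ballCoeff, ball_inter_preimage_smul_of_mem_U1 hr hy, ha y hy, one_mul,
      indicator_of_mem hy]
  · rw [ballCoeff, ball_inter_preimage_smul_of_not_mem_U1 hr hy, indicator_of_notMem hy,
      measureReal_empty, Complex.ofReal_zero, mul_zero]

/-- tex l. 622–623: "`I_v(φ_v) = vol(D)·vol(U₁)`", for any measure `η` (PerL: `d^×y`) and any `χ`
trivial on `U₁` (PerL: `U₁ ⊂ ker χ'_v`, l. 620). -/
theorem integral_ballCoeff_mul_eq [MeasurableSpace F] [OpensMeasurableSpace F]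
    {a χ : F → ℂ} {μ : Measure (ι → F)} {x₀ : ι → F} {r : ℝ} (hr : r < ‖x₀‖) (hr0 : 0 < r)
    (η : Measure F) (ha : ∀ y ∈ U1 x₀ r, a y = 1) (hχ : ∀ y ∈ U1 x₀ r, χ y = 1) :
    ∫ y, ballCoeff a μ x₀ r y * χ y ∂η
      = ((μ.real (closedBall x₀ r) * η.real (U1 x₀ r) : ℝ) : ℂ) := by
  have hmeas : MeasurableSet (U1 x₀ r) := (isOpen_U1 hr0).measurableSet
  have hfun : (fun y => ballCoeff a μ x₀ r y * χ y)
      = (U1 x₀ r).indicator fun _ => (μ.real (closedBall x₀ r) : ℂ) := by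
    funext y
    rw [ballCoeff_eq_indicator hr ha]
    by_cases hy : y ∈ U1 x₀ r
    · rw [indicator_of_mem hy, hχ y hy, mul_one]
    · rw [indicator_of_notMem hy, zero_mul]
  rw [hfun, integral_indicator_const _ hmeas, Complex.real_smul, Complex.ofReal_mul, mul_comm]

omit [IsUltrametricDist F] in
/-- `vol(D) > 0` (and finite): tex l. 623 "`> 0`", first factor. -/
theorem measureReal_ball_pos {μ : Measure (ι → F)} [μ.IsOpenPosMeasure]
    [IsFiniteMeasureOnCompacts μ] [ProperSpace (ι → F)] (x₀ : ι → F) {r : ℝ} (hr0 : 0 < r) :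
    0 < μ.real (closedBall x₀ r) :=
  ENNReal.toReal_pos (measure_closedBall_pos μ x₀ hr0).ne' measure_closedBall_lt_top.ne

omit [IsUltrametricDist F] [MeasurableSpace (ι → F)] in
/-- `vol(U₁) > 0` (and finite): tex l. 623 "`> 0`", second factor (`U₁` is a ball about `1`). -/
theorem measureReal_U1_pos [MeasurableSpace F] {η : Measure F} [η.IsOpenPosMeasure]
    [IsFiniteMeasureOnCompacts η] [ProperSpace F] {x₀ : ι → F} (hx : x₀ ≠ 0) {r : ℝ}
    (hr0 : 0 < r) : 0 < η.real (U1 x₀ r) := by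
  rw [U1_eq_closedBall hx]
  exact ENNReal.toReal_pos (measure_closedBall_pos η _ (div_pos hr0 (norm_pos_iff.mpr hx))).ne'
    measure_closedBall_lt_top.ne

omit [IsUltrametricDist F] in
/-- tex l. 623: `vol(D)·vol(U₁) > 0`. -/
theorem ballFactor_pos [MeasurableSpace F] {μ : Measure (ι → F)} [μ.IsOpenPosMeasure]
    [IsFiniteMeasureOnCompacts μ] [ProperSpace (ι → F)] {η : Measure F} [η.IsOpenPosMeasure]
    [IsFiniteMeasureOnCompacts η] [ProperSpace F] {x₀ : ι → F} (hx : x₀ ≠ 0) {r : ℝ}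
    (hr0 : 0 < r) : 0 < μ.real (closedBall x₀ r) * η.real (U1 x₀ r) :=
  mul_pos (measureReal_ball_pos x₀ hr0) (measureReal_U1_pos hx hr0)

/-- **N31f, split place, conclusion** (tex ll. 617–623): with `φ_v = 𝟙_D`, `N > ord(x₀)`
(`r < ‖x₀‖`, `0 < r`), the local factor `I_v(φ_v) = ∫ m(y)χ'_v(y) d^×y` is a POSITIVE REAL number,
namely `vol(D)·vol(U₁)`. -/
theorem exists_integral_ballCoeff_pos [MeasurableSpace F] [BorelSpace F]
    {μ : Measure (ι → F)} [μ.IsOpenPosMeasure] [IsFiniteMeasureOnCompacts μ] [ProperSpace (ι → F)]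
    (η : Measure F) [η.IsOpenPosMeasure] [IsFiniteMeasureOnCompacts η] [ProperSpace F]
    {a χ : F → ℂ} {x₀ : ι → F} {r : ℝ} (hr : r < ‖x₀‖) (hr0 : 0 < r)
    (ha : ∀ y ∈ U1 x₀ r, a y = 1) (hχ : ∀ y ∈ U1 x₀ r, χ y = 1) :
    ∃ c : ℝ, 0 < c ∧ ∫ y, ballCoeff a μ x₀ r y * χ y ∂η = (c : ℂ) := by
  have hx : x₀ ≠ 0 := by
    intro h
    rw [h, norm_zero] at hr
    exact absurd (hr0.trans hr) (lt_irrefl 0)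
  exact ⟨_, ballFactor_pos hx hr0, integral_ballCoeff_mul_eq hr hr0 η ha hχ⟩

/-! ### `d^×y` versus `dy` on `U₁ ⊂ 𝒪^×` -/

omit [MeasurableSpace (ι → F)] in
/-- On `U₁ ⊂ 𝒪^×` the multiplicative Haar measure `d^×y = |y|⁻¹ dy` (up to normalisation) agrees
with `dy`: for any measure `η` on `F`, `(|·|⁻¹ · η)(U₁) = η(U₁)`.  So `vol(U₁)` may be read for
either measure in `integral_ballCoeff_mul_eq` / `ballFactor_pos`. -/
theorem withDensity_inv_norm_U1 [MeasurableSpace F] [OpensMeasurableSpace F] (η : Measure F)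
    {x₀ : ι → F} {r : ℝ} (hr : r < ‖x₀‖) (hr0 : 0 < r) :
    η.withDensity (fun y => (‖y‖₊ : ENNReal)⁻¹) (U1 x₀ r) = η (U1 x₀ r) := by
  have hmeas : MeasurableSet (U1 x₀ r) := (isOpen_U1 hr0).measurableSet
  rw [withDensity_apply _ hmeas]
  have h1 : ∀ y ∈ U1 x₀ r, (fun y : F => ((‖y‖₊ : ENNReal)⁻¹)) y = 1 := by
    intro y hy
    have hy1 : ‖y‖₊ = 1 := by
      ext
      rw [coe_nnnorm, norm_eq_one_of_mem_U1 hr hy, NNReal.coe_one]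
    simp only [hy1, ENNReal.coe_one, inv_one]
  rw [setLIntegral_congr_fun hmeas h1, setLIntegral_one]

end LocalFactors
end PerL34
end HodgeCM
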